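import Mathlib
import Literature.Analysis.FluidPDE.AxisymNoSwirlWeightedCoSignedFlux
import Literature.Analysis.FluidPDE.AxisymBiotSavartSupBound
import HarnessLib.Audit
import HarnessLib

/-!
# L3TimeExponentPincer — ring persistence, dynamic lemmas: the scalar bootstrap, the speed bound
# `‖u‖_∞ ≤ 3√(M‖ω‖₁)` along the flow, and the transport pairing bound `|∫ η⁻ 2(x_h·u)| ≤ 2‖u‖_∞ ∫ rη⁻`

Support kernel for the crux `L3CascadeJaw` (route `L3TimeExponentPincer`, item
stmt-NavierStokesRegularity-19499), serving the PERSISTENCE LEMMA `LpPersistence 3 (1/2) 2` of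
`L3TimeExponentPincerQuantJaw` (ROUND-11/12 of seat nsreg-p2).  The dynamic half of the lemma is
an a-priori bound, uniform over `≍ Re` turnovers, of the absolute impulse
`Q(t) = ∫ r²|η(t)| dx` (`η = ω_θ/r`) of a swirl-free axisymmetric flow whose datum is a vortex
ring plus a dilute counter-rotating shell (the Schwartz-frame substitute of a pure ring).  Its
inputs are the weighted co-signed flux (`AxisymNoSwirlWeightedCoSignedFlux`,
`∫ r²η^±(t) ≤ ∫ r²η^±(0) + ∫₀ᵗ∫ η^± 2(x_h·u)`), the Lamb identity `∫ η (x_h·u) = 0`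
(`AxisymNoSwirlImpulseSlice`), the maximum principle `|η| ≤ M`, the `L¹` co-signed bounds, and the
axisymmetric Biot–Savart bound (`AxisymBiotSavartSupBound`).  This file supplies the three
elementary dynamic lemmas:

* `scalar_bootstrap` — if `0 ≤ S ≤ Q + a S^{3/4}` with `Q > 0` and `a ≤ Q^{1/4}/2` then `S ≤ 2Q`
  (the sub-linear closing of `Q(t) ≤ Q₀ + K∫₀ᵗ Q^{3/4}` on the window `Kt ≤ Q₀^{1/4}/2`, run on the
  supremum `S = sup_{s≤t} Q(s)` — no differential inequality is needed);
* `speed_le_of_vorticityMass` — along a Tao-class solution (`0 < ν`) from an axisymmetric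
  swirl-free datum with `|η₀| ≤ M`, at every time whose vorticity is integrable:
  `‖u(t,x)‖ ≤ 3 √(M ∫‖ω(t)‖)` (Gallay–Šverák (2.14) with the tree's constant `3`, maximum principle
  `‖ω(t)‖ ≤ M r`, `u(t) = K₃ ∗ ω(t)`), and `vorticityMass_le_sqrt`:
  `∫‖ω(t)‖ = ∫ r|η(t)| ≤ √(∫|η(t)|) √(∫ r²|η(t)|)`;
* `abs_integral_negPart_mul_horizontal_le` — the transport pairing of the negative part:
  `|∫ η⁻(t) · 2(x₀u₀ + x₁u₁)(t)| ≤ 2 B ∫ r η⁻(t)` for `‖u(t)‖ ≤ B`, with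
  `∫ r η⁻ ≤ √(∫η⁻) √(∫ r²η⁻)`; and `integral_posPart_mul_horizontal_eq` — by the Lamb identity the
  positive part has the SAME pairing: `∫ η⁺ 2(x_h·u) = ∫ η⁻ 2(x_h·u)`.

WHAT THIS IS NOT: not a statement about Navier–Stokes blow-up — a-priori lemmas for smooth
swirl-free axisymmetric flows; the persistence lemma's assembly is the sequel.
-/

namespace Summit.NavierStokesRegularity.NavierStokesRegularity.Theorems.L3TimeExponentPincerRingPersistenceDynamics

open MeasureTheory Set Real Literature.Analysis.FluidPDE
open scoped ENNReal NNReal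

/-! ### §1  The scalar bootstrap -/

/-- **Scalar bootstrap**: `0 ≤ S`, `0 < Q`, `S ≤ Q + a S^{3/4}` and `a ≤ Q^{1/4}/2` imply
`S ≤ 2Q` (if `S > Q` then `S^{3/4} ≤ S/Q^{1/4}`, so `a S^{3/4} ≤ S/2`). -/
theorem scalar_bootstrap {S Q a : ℝ} (hS : 0 ≤ S) (hQ : 0 < Q)
    (haQ : a ≤ Q ^ (1 / 4 : ℝ) / 2) (hle : S ≤ Q + a * S ^ (3 / 4 : ℝ)) : S ≤ 2 * Q := by
  rcases le_or_gt S Q with h | h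
  · linarith
  · have hSpos : 0 < S := hQ.trans h
    have hQ4 : Q ^ (1 / 4 : ℝ) ≤ S ^ (1 / 4 : ℝ) := Real.rpow_le_rpow hQ.le h.le (by norm_num)
    have hsplit : S ^ (1 / 4 : ℝ) * S ^ (3 / 4 : ℝ) = S := by
      rw [← Real.rpow_add hSpos]; norm_num
    have h34 : 0 ≤ S ^ (3 / 4 : ℝ) := Real.rpow_nonneg hS _
    have key : a * S ^ (3 / 4 : ℝ) ≤ S / 2 := by
      calc a * S ^ (3 / 4 : ℝ) ≤ (Q ^ (1 / 4 : ℝ) / 2) * S ^ (3 / 4 : ℝ) :=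
            mul_le_mul_of_nonneg_right haQ h34
        _ ≤ (S ^ (1 / 4 : ℝ) / 2) * S ^ (3 / 4 : ℝ) := by gcongr
        _ = S / 2 := by rw [div_mul_eq_mul_div, hsplit]
    linarith

/-! ### §2  Cauchy–Schwarz for the moments of `η^±` -/

/-- `∫ r f ≤ √(∫ f) √(∫ r² f)` for a nonnegative `f` with `f, r²f ∈ L¹` (`r = cylRadius`). -/
theorem integral_cylRadius_mul_le_sqrt_of_nonneg {f : EuclideanSpace ℝ (Fin 3) → ℝ}
    (hf0 : ∀ x, 0 ≤ f x) (h1 : Integrable f) (h2 : Integrable fun x => cylRadius x ^ 2 * f x) :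
    ∫ x, cylRadius x * f x ≤ Real.sqrt (∫ x, f x) * Real.sqrt (∫ x, cylRadius x ^ 2 * f x) := by
  have h := integral_cylRadius_mul_le_sqrt h1 h2
  have e1 : (fun x => cylRadius x * |f x|) = fun x => cylRadius x * f x :=
    funext fun x => by rw [abs_of_nonneg (hf0 x)]
  have e2 : (fun x => |f x|) = fun x => f x := funext fun x => abs_of_nonneg (hf0 x)
  have e3 : (fun x => cylRadius x ^ 2 * |f x|) = fun x => cylRadius x ^ 2 * f x :=
    funext fun x => by rw [abs_of_nonneg (hf0 x)]
  rw [e1, e2, e3] at h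
  exact h

/-! ### §3  The speed bound along the flow -/

section Speed

variable {T ν : ℝ} {u₀ : EuclideanSpace ℝ (Fin 3) → EuclideanSpace ℝ (Fin 3)}
  {u : ℝ → EuclideanSpace ℝ (Fin 3) → EuclideanSpace ℝ (Fin 3)}
  {p : ℝ → EuclideanSpace ℝ (Fin 3) → ℝ}

/-- **`‖u(t,x)‖ ≤ 3 √(M ∫‖ω(t)‖)`** along a Tao-class solution (`0 < ν`, `0 < T`) from an
axisymmetric swirl-free datum with `|η₀| ≤ M`, at every `t ∈ [0, T]` at which the vorticity is
integrable: the axisymmetric Biot–Savart bound (Gallay–Šverák 2015 (2.14), tree constant `3`)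
for `ω(t)`, which is axisymmetric with `‖ω(t)‖ ≤ M r` (maximum principle for `ω_θ/r`), and
`u(t) = K₃ ∗ ω(t)`. -/
theorem speed_le_of_vorticityMass (h : IsTaoSolutionOn T ν u₀ u p) (hT : 0 < T) (hν : 0 < ν)
    (h0 : IsAxisymmetric u₀) (h0' : HasNoSwirl u₀) {M : ℝ} (hM : ∀ x, |angVortQuot u₀ x| ≤ M)
    {t : ℝ} (ht : t ∈ Icc 0 T) (hint : Integrable (curl (u t))) (x : EuclideanSpace ℝ (Fin 3)) :
    ‖u t x‖ ≤ 3 * Real.sqrt ((∫ y, ‖curl (u t) y‖) * M) := by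
  have hax : IsAxisymmetric (u t) := h.isAxisymmetric hν hT h0 t ht
  have hu1 : ContDiff ℝ 1 (u t) := (h.classical.contDiff_velocity ht).of_le (by norm_cast)
  have hωax : IsAxisymmetric (curl (u t)) := hax.curl (hu1.differentiable (by simp))
  have hrot : ∀ θ y, ‖curl (u t) (rotZ θ y)‖ = ‖curl (u t) y‖ := fun θ y => by
    rw [hωax θ y, norm_rotZ]
  have hωM : ∀ y, ‖curl (u t) y‖ ≤ M * cylRadius y := fun y =>
    h.norm_curl_le_mul_cylRadius_of_datum hT hν h0 h0' hM ht y
  have hωc : Continuous (curl (u t)) := continuous_curl hu1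
  have hBS := norm_biotSavart_le_sqrt_of_norm_le_mul_cylRadius hωc hint hrot hωM x
  rwa [h.biotSavart_curl_eq ht hint] at hBS

/-- **`∫‖ω(t)‖ ≤ √(∫|η(t)|) √(∫ r²|η(t)|)`** for an axisymmetric swirl-free slice
(`‖ω‖ = r|η|`, Cauchy–Schwarz), given `η(t), r²η(t) ∈ L¹`. -/
theorem vorticityMass_le_sqrt (h : IsTaoSolutionOn T ν u₀ u p) (hT : 0 < T) (hν : 0 < ν)
    (h0 : IsAxisymmetric u₀) (h0' : HasNoSwirl u₀) {t : ℝ} (ht : t ∈ Icc 0 T)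
    (h1 : Integrable (angVortQuot (u t)))
    (h2 : Integrable fun x => cylRadius x ^ 2 * angVortQuot (u t) x) :
    Integrable (curl (u t)) ∧
    ∫ y, ‖curl (u t) y‖ ≤ Real.sqrt (∫ y, |angVortQuot (u t) y|) *
      Real.sqrt (∫ y, cylRadius y ^ 2 * |angVortQuot (u t) y|) := by
  have hax : IsAxisymmetric (u t) := h.isAxisymmetric hν hT h0 t ht
  have hsw : HasNoSwirl (u t) := h.hasNoSwirl hν hT h0 h0' t ht
  have hu3 : ContDiff ℝ 3 (u t) := (h.classical.contDiff_velocity ht).of_le (by norm_cast)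
  have hu1 : ContDiff ℝ 1 (u t) := hu3.of_le (by norm_cast)
  have hωeq : ∀ y, ‖curl (u t) y‖ = cylRadius y * |angVortQuot (u t) y| :=
    norm_curl_eq_cylRadius_mul_abs_angVortQuot hax hsw hu3
  have h2' : Integrable fun x => cylRadius x ^ 2 * |angVortQuot (u t) x| := by
    have : (fun x => cylRadius x ^ 2 * |angVortQuot (u t) x|) =
        fun x => |cylRadius x ^ 2 * angVortQuot (u t) x| := by
      funext x; rw [abs_mul, abs_of_nonneg (sq_nonneg (cylRadius x))]
    rw [this]; exact h2.abs
  have hωint : Integrable (curl (u t)) := by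
    refine Integrable.mono' ((h1.abs.add h2').div_const 2) (continuous_curl hu1).aestronglyMeasurable
      (Filter.Eventually.of_forall fun y => ?_)
    rw [hωeq y]
    show cylRadius y * |angVortQuot (u t) y| ≤
      (|angVortQuot (u t) y| + cylRadius y ^ 2 * |angVortQuot (u t) y|) / 2
    nlinarith [mul_nonneg (sq_nonneg (cylRadius y - 1)) (abs_nonneg (angVortQuot (u t) y))]
  refine ⟨hωint, ?_⟩
  calc ∫ y, ‖curl (u t) y‖ = ∫ y, cylRadius y * |angVortQuot (u t) y| :=
        integral_congr_ae (Filter.Eventually.of_forall hωeq)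
    _ ≤ _ := integral_cylRadius_mul_le_sqrt h1 h2

end Speed

/-! ### §4  The transport pairings of `η⁺` and `η⁻` -/

section Transport

variable {T ν : ℝ} {u₀ : EuclideanSpace ℝ (Fin 3) → EuclideanSpace ℝ (Fin 3)}
  {u : ℝ → EuclideanSpace ℝ (Fin 3) → EuclideanSpace ℝ (Fin 3)}
  {p : ℝ → EuclideanSpace ℝ (Fin 3) → ℝ}

/-- **The transport pairing of the negative part is controlled by its first moment**: for a
continuous field `w` with `‖w‖ ≤ B` and a nonnegative `f` with `f, r f ∈ L¹`:
`|∫ f · 2(x₀w₀ + x₁w₁)| ≤ 2B ∫ r f`. -/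
theorem abs_integral_mul_horizontal_le {f : EuclideanSpace ℝ (Fin 3) → ℝ}
    {w : EuclideanSpace ℝ (Fin 3) → EuclideanSpace ℝ (Fin 3)} (hf0 : ∀ x, 0 ≤ f x)
    (hrf : Integrable fun x => cylRadius x * f x) {B : ℝ} (hwB : ∀ x, ‖w x‖ ≤ B) :
    |∫ x, f x * (2 * (x 0 * w x 0 + x 1 * w x 1))| ≤ 2 * B * ∫ x, cylRadius x * f x := by
  have hB0 : 0 ≤ B := (norm_nonneg _).trans (hwB 0)
  calc |∫ x, f x * (2 * (x 0 * w x 0 + x 1 * w x 1))|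
      ≤ ∫ x, |f x * (2 * (x 0 * w x 0 + x 1 * w x 1))| := by
        have := norm_integral_le_integral_norm (μ := (volume : Measure (EuclideanSpace ℝ (Fin 3))))
          (fun x => f x * (2 * (x 0 * w x 0 + x 1 * w x 1)))
        simpa only [Real.norm_eq_abs] using this
    _ ≤ ∫ x, 2 * B * (cylRadius x * f x) := by
        refine integral_mono_of_nonneg (Filter.Eventually.of_forall fun x => abs_nonneg _)
          (hrf.const_mul _) (Filter.Eventually.of_forall fun x => ?_)
        show |f x * (2 * (x 0 * w x 0 + x 1 * w x 1))| ≤ 2 * B * (cylRadius x * f x)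
        rw [abs_mul, abs_of_nonneg (hf0 x), abs_mul, abs_two]
        have hh : |x 0 * w x 0 + x 1 * w x 1| ≤ cylRadius x * B :=
          (abs_horizontal_inner_le x (w x)).trans (mul_le_mul_of_nonneg_left (hwB x) (cylRadius_nonneg x))
        calc f x * (2 * |x 0 * w x 0 + x 1 * w x 1|) ≤ f x * (2 * (cylRadius x * B)) := by
              gcongr; exact hf0 x
          _ = 2 * B * (cylRadius x * f x) := by ring
    _ = 2 * B * ∫ x, cylRadius x * f x := integral_const_mul _ _

/-- **The positive part has the same transport pairing as the negative part** (Lamb identity):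
along a Tao-class solution (`0 < ν`, `0 < T`) from an axisymmetric swirl-free datum, at every
`t ∈ [0, T]` at which `η(t) ∈ L¹` and `r η^±(t) ∈ L¹`,
`∫ η⁺(t) · 2(x₀u₀ + x₁u₁)(t) = ∫ η⁻(t) · 2(x₀u₀ + x₁u₁)(t)` — because `η⁺ − η⁻ = η` and
`∫ η (x₀u₀ + x₁u₁) = 0` (`IsTaoSolutionOn.integral_angVortQuot_mul_horizontal_eq_zero`). -/
theorem integral_posPart_mul_horizontal_eq (h : IsTaoSolutionOn T ν u₀ u p) (hT : 0 < T)
    (hν : 0 < ν) (h0 : IsAxisymmetric u₀) (h0' : HasNoSwirl u₀) {t : ℝ} (ht : t ∈ Icc 0 T)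
    (hp : Integrable fun x => (angVortQuot (u t) x)⁺ * (2 * (x 0 * u t x 0 + x 1 * u t x 1)))
    (hn : Integrable fun x => (angVortQuot (u t) x)⁻ * (2 * (x 0 * u t x 0 + x 1 * u t x 1))) :
    ∫ x, (angVortQuot (u t) x)⁺ * (2 * (x 0 * u t x 0 + x 1 * u t x 1)) =
      ∫ x, (angVortQuot (u t) x)⁻ * (2 * (x 0 * u t x 0 + x 1 * u t x 1)) := by
  have hL := h.integral_angVortQuot_mul_horizontal_eq_zero hT hν h0 h0' ht
  have hsub : ∫ x, ((angVortQuot (u t) x)⁺ * (2 * (x 0 * u t x 0 + x 1 * u t x 1)) -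
      (angVortQuot (u t) x)⁻ * (2 * (x 0 * u t x 0 + x 1 * u t x 1))) = 0 := by
    have e : (fun x => (angVortQuot (u t) x)⁺ * (2 * (x 0 * u t x 0 + x 1 * u t x 1)) -
        (angVortQuot (u t) x)⁻ * (2 * (x 0 * u t x 0 + x 1 * u t x 1))) =
        fun x => 2 * (angVortQuot (u t) x * (x 0 * u t x 0 + x 1 * u t x 1)) := by
      funext x
      have hpn : (angVortQuot (u t) x)⁺ - (angVortQuot (u t) x)⁻ = angVortQuot (u t) x :=
        posPart_sub_negPart _
      rw [← sub_mul, hpn]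
      ring
    rw [e, integral_const_mul, hL, mul_zero]
  rw [integral_sub hp hn] at hsub
  linarith

end Transport

/--
info: 'Summit.NavierStokesRegularity.NavierStokesRegularity.Theorems.L3TimeExponentPincerRingPersistenceDynamics.speed_le_of_vorticityMass' depends on axioms: [propext,
 Classical.choice,
 Quot.sound]
-/
#guard_msgs in
#print axioms speed_le_of_vorticityMass

/--
info: 'Summit.NavierStokesRegularity.NavierStokesRegularity.Theorems.L3TimeExponentPincerRingPersistenceDynamics.integral_posPart_mul_horizontal_eq' depends on axioms: [propext,
 Classical.choice,
 Quot.sound]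
-/
#guard_msgs in
#print axioms integral_posPart_mul_horizontal_eq

end Summit.NavierStokesRegularity.NavierStokesRegularity.Theorems.L3TimeExponentPincerRingPersistenceDynamics
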